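import Summits.ValiantsHypothesis.ValiantsHypothesis.Theorems.LacunarySymmetroidMatrixDescartesGraftToolkit

/-!
# `MatrixDescartes` census — THE GRAFT LAW for all formats: one more letter buys `m` more alternations

HONEST FRAMING.  Object-search cell `pub-symmetroid`, crux `Theses.LacunarySymmetroid.MatrixDescartes`
(stmt-ValiantsHypothesis-18050); seat val-sym-mdr-p1 (g3).  LOWER-bound / construction mathematics in census
(CONJECTURE-A) currency: the `Γ = 0` part of the cell's A-flag ladder `ζ(m,K+1) ≥ ζ(m,K) + m + Γ_m(K)`
(`HOME/CONJECTURE.md` §3), in the kernel, for EVERY format and from ANY alternation certificate.  It proves nothing about the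
crux `MatrixDescartes` (an UPPER-bound statement at fat formats), nothing about `DoorA26` / `DoorA34`, and nothing about
`VP ≠ VNP`.  No definitions in this file.

THE GRAFT STEP (`exists_alternating_succ`).  Let `F = ∑ l, X^(d l) • S l` be a real symmetric `K`-term `m × m` lacunary pencil
and `0 < τ 0 < ⋯ < τ N` test points at which `det F(τ j) ≠ 0` with consecutive values of opposite signs (`N` alternations).  Put
`x₀ = τ N`, and let `U` be a real orthogonal eigenframe of the symmetric invertible matrix `F(x₀)`:  `Uᵀ F(x₀) U = diagonal λ`,
`λ_b ≠ 0` (toolkit `exists_orth_frame`).  In the `U`-frame all trailing principal minors of `F(x₀)` are nonzero, hence (continuity)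
keep their signs on `[x₀, x₀ + ε)`.  Graft the letter `X^D • diagonal (−λ_b · θ_b^{−D})` with thresholds `θ_b = x₀ + (2b+1)η` and new
test points `p_a = x₀ + 2aη` (`a = 0, …, m`, `2mη < ε`).  As `D → ∞`: below `x₀` the new letter dies (`det → det F`, the `N` old
alternations persist); at `p_a` the coordinates `b < a` are ON and the tree's FLAG LEMMA (`Census.Flag.eventually_det_mul_pos`, seat g2)
gives the eventual sign `sign (∏_{b<a} (−λ_b) · ∏_{b ≥ a} λ_b) = (−1)^a · sign det F(x₀)` — `m` further alternations.  Finitely many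
eventual statements ⇒ one `D`.  Everything is stated def-free, in the evaluated-determinant shape of the census certificate lemmas
(`Census.le_card_roots_pencil_of_alternating`).  `exists_alternating_add` iterates: `j` more letters ⇒ `j·m` more alternations.
The companion `…GraftLawFloor.lean` feeds in the seat's P4 witness: `ζ_sym(m,K) ≥ m² + (K−2)·m` for every `m ≥ 1`, `K ≥ 4`.
[folklore] throughout (spectral theorem, intermediate value theorem, dominant geometric rate).
-/

-- `Summit.ValiantsHypothesis.ValiantsHypothesis.…` repeats a component by the D-0017 layout
-- (single-conjunct summit), which the `dupNamespace` linter flags; the name is mandated.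
set_option linter.dupNamespace false

namespace Summit.ValiantsHypothesis.ValiantsHypothesis.Theorems.LacunarySymmetroidMatrixDescartes.Census.Graft

open Matrix Finset Filter Topology
open scoped BigOperators

/-! ### The graft step -/

/-- **THE GRAFT STEP (all formats).**  From a real symmetric `K`-term `m × m` lacunary pencil whose determinant takes nonzero
values of alternating signs at positive test points `τ 0 < ⋯ < τ N` (`N` alternations), a real symmetric `(K+1)`-term `m × m`
pencil — the old letters in an orthogonal eigenframe of `F(τ N)` plus ONE new diagonal letter at a larger exponent — whose
determinant alternates along `N + m + 1` positive test points (`N + m` alternations).  In census words: `ζ(m,K+1) ≥ ζ_alt(m,K) + m`.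
The old exponents are kept (`d' ∘ castSucc = d`) and the new one exceeds them. [folklore] -/
theorem exists_alternating_succ {m K N : ℕ} (d : Fin K → ℕ) (S : Fin K → Matrix (Fin m) (Fin m) ℝ)
    (hS : ∀ l, (S l).IsSymm) (τ : Fin (N + 1) → ℝ) (hτ : StrictMono τ) (hpos : ∀ j, 0 < τ j)
    (hne : ∀ j, (∑ l, τ j ^ d l • S l).det ≠ 0)
    (halt : ∀ j : Fin N, (∑ l, τ j.castSucc ^ d l • S l).det * (∑ l, τ j.succ ^ d l • S l).det < 0) :
    ∃ (d' : Fin (K + 1) → ℕ) (S' : Fin (K + 1) → Matrix (Fin m) (Fin m) ℝ) (τ' : Fin (N + m + 1) → ℝ),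
      (∀ l : Fin K, d' l.castSucc = d l) ∧ (∀ l : Fin K, d l < d' (Fin.last K)) ∧
      (∀ l, (S' l).IsSymm) ∧ StrictMono τ' ∧ (∀ j, 0 < τ' j) ∧
      (∀ j, (∑ l, τ' j ^ d' l • S' l).det ≠ 0) ∧
      ∀ j : Fin (N + m), (∑ l, τ' j.castSucc ^ d' l • S' l).det * (∑ l, τ' j.succ ^ d' l • S' l).det < 0 := by
  classical
  -- the last test point and an orthogonal eigenframe of the pencil there
  set x₀ : ℝ := τ (Fin.last N) with hx₀
  have hx₀pos : 0 < x₀ := hpos _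
  set M₀ : Matrix (Fin m) (Fin m) ℝ := ∑ l, x₀ ^ d l • S l with hM₀
  have hM₀symm : M₀.IsSymm := isSymm_sum_smul _ S hS
  have hM₀det : M₀.det ≠ 0 := hne (Fin.last N)
  obtain ⟨U, lam, hUUt, -, hdiag⟩ := exists_orth_frame M₀ hM₀symm
  -- the conjugated letters
  set T : Fin K → Matrix (Fin m) (Fin m) ℝ := fun l => Uᵀ * S l * U with hT
  have hTsymm : ∀ l, (T l).IsSymm := fun l => isSymm_transpose_mul_mul U (hS l)
  have hMc : ∀ y : ℝ, ∑ l, y ^ d l • T l = Uᵀ * (∑ l, y ^ d l • S l) * U := fun y =>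
    (transpose_mul_sum_smul_mul U (fun l => y ^ d l) S).symm
  have hMc_det : ∀ y : ℝ, (∑ l, y ^ d l • T l).det = (∑ l, y ^ d l • S l).det := fun y => by
    rw [hMc, det_transpose_mul_mul U hUUt]
  have hMc₀ : ∑ l, x₀ ^ d l • T l = diagonal lam := by rw [hMc, ← hM₀]; exact hdiag
  have hdetM₀ : M₀.det = ∏ b, lam b := by
    rw [← det_transpose_mul_mul U hUUt M₀, hdiag, det_diagonal]
  have hlam : ∀ b, lam b ≠ 0 := fun b hb =>
    hM₀det (by rw [hdetM₀]; exact Finset.prod_eq_zero (Finset.mem_univ b) hb)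
  have hprodne : ∏ b, lam b ≠ 0 := Finset.prod_ne_zero_iff.mpr fun b _ => hlam b
  -- ON sets, trailing minors in the eigenframe, and their values at `x₀`
  set ON : ℕ → Finset (Fin m) := fun a => univ.filter (fun b : Fin m => (b : ℕ) < a) with hON
  set μ : ℕ → ℝ → ℝ := fun a y =>
    ((∑ l, y ^ d l • T l).submatrix ((↑) : ↥((ON a)ᶜ) → Fin m) ((↑) : ↥((ON a)ᶜ) → Fin m)).det with hμ
  set Λ : ℕ → ℝ := fun a => ∏ b ∈ (ON a)ᶜ, lam b with hΛ
  have hΛne : ∀ a, Λ a ≠ 0 := fun a => Finset.prod_ne_zero_iff.mpr fun b _ => hlam b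
  have hμx₀ : ∀ a, μ a x₀ = Λ a := by
    intro a
    show ((∑ l, x₀ ^ d l • T l).submatrix ((↑) : ↥((ON a)ᶜ) → Fin m) ((↑) : ↥((ON a)ᶜ) → Fin m)).det
      = ∏ b ∈ (ON a)ᶜ, lam b
    rw [hMc₀, Matrix.submatrix_diagonal _ _ Subtype.val_injective, det_diagonal]
    simp only [Function.comp_apply]
    exact Finset.prod_coe_sort ((ON a)ᶜ) lam
  -- continuity: near `x₀` every trailing minor keeps the sign of its value at `x₀`
  have hnear : ∀ᶠ y in 𝓝 x₀, ∀ a : Fin (m + 1), 0 < μ a y * Λ a := by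
    refine eventually_all.mpr fun a => ?_
    have hc : Continuous (μ a) := continuous_det_submatrix_pencil d T _
    have ht : Tendsto (μ a) (𝓝 x₀) (𝓝 (Λ a)) := by rw [← hμx₀]; exact hc.tendsto x₀
    exact eventually_mul_pos_of_tendsto ht (hΛne a)
  obtain ⟨ε, hε, hball⟩ := Metric.eventually_nhds_iff.mp hnear
  -- scales: thresholds `θ_b = x₀ + (2b+1)η`, new test points `x₀ + 2aη`, signs `σ_b = -λ_b`
  set η : ℝ := ε / (2 * m + 2) with hη
  have hηpos : 0 < η := by rw [hη]; positivity
  have h2mη : 2 * (m : ℝ) * η < ε := by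
    rw [hη, show 2 * (m : ℝ) * (ε / (2 * m + 2)) = ε * (2 * m) / (2 * m + 2) by ring,
      div_lt_iff₀ (by positivity)]
    nlinarith
  set θ : Fin m → ℝ := fun b => x₀ + (2 * ((b : ℕ) : ℝ) + 1) * η with hθ
  set σ : Fin m → ℝ := fun b => -lam b with hσ
  have hθgt : ∀ b, x₀ < θ b := fun b => by
    show x₀ < x₀ + (2 * ((b : ℕ) : ℝ) + 1) * η
    have : 0 < (2 * ((b : ℕ) : ℝ) + 1) * η := by positivity
    linarith
  have hθpos : ∀ b, 0 < θ b := fun b => hx₀pos.trans (hθgt b)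
  have hσne : ∀ b, σ b ≠ 0 := fun b => neg_ne_zero.mpr (hlam b)
  -- eventual sign at the NEW test points `x₀ + 2aη`, `a ≤ m`: carrier `(-1)^a ∏ λ`
  have hnew : ∀ a : ℕ, a ≤ m → ∀ᶠ D : ℕ in atTop,
      0 < ((∑ l, (x₀ + 2 * (a : ℝ) * η) ^ d l • T l)
            + diagonal (fun b => σ b * ((x₀ + 2 * (a : ℝ) * η) / θ b) ^ D)).det
          * ((-1) ^ a * ∏ b, lam b) := by
    intro a ha
    set y : ℝ := x₀ + 2 * (a : ℝ) * η with hy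
    have h2aη : 0 ≤ 2 * (a : ℝ) * η := mul_nonneg (mul_nonneg zero_le_two (Nat.cast_nonneg a)) hηpos.le
    have hypos : 0 < y := add_pos_of_pos_of_nonneg hx₀pos h2aη
    have hyx : dist y x₀ < ε := by
      rw [Real.dist_eq, hy, add_sub_cancel_left, abs_of_nonneg h2aη]
      have : (a : ℝ) ≤ m := by exact_mod_cast ha
      nlinarith
    have hμy : 0 < μ a y * Λ a := hball hyx ⟨a, Nat.lt_succ_of_le ha⟩
    have hμne : μ a y ≠ 0 := fun h0 => by rw [h0, zero_mul] at hμy; exact lt_irrefl 0 hμy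
    set r : Fin m → ℝ := fun b => y / θ b with hr
    have hrpos : ∀ b, 0 < r b := fun b => div_pos hypos (hθpos b)
    have hrON : ∀ b, b ∈ ON a ↔ 1 < r b := by
      intro b
      show b ∈ univ.filter (fun b : Fin m => (b : ℕ) < a) ↔ 1 < y / θ b
      rw [Finset.mem_filter, one_lt_div (hθpos b)]
      simp only [Finset.mem_univ, true_and]
      show (b : ℕ) < a ↔ x₀ + (2 * ((b : ℕ) : ℝ) + 1) * η < x₀ + 2 * (a : ℝ) * η
      constructor
      · intro hb
        have h' : 2 * ((b : ℕ) : ℝ) + 1 < 2 * (a : ℝ) := by exact_mod_cast (by omega : 2 * (b : ℕ) + 1 < 2 * a)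
        nlinarith
      · intro hlt
        have h' : (2 * ((b : ℕ) : ℝ) + 1) * η < 2 * (a : ℝ) * η := by linarith
        have h'' : 2 * ((b : ℕ) : ℝ) + 1 < 2 * (a : ℝ) := lt_of_mul_lt_mul_right h' hηpos.le
        have : 2 * (b : ℕ) + 1 < 2 * a := by exact_mod_cast h''
        omega
    have hr1 : ∀ b, r b ≠ 1 := by
      intro b h1
      have hyθ : y = θ b := (div_eq_one_iff_eq (hθpos b).ne').mp h1
      have h2 : 2 * (a : ℝ) * η = (2 * ((b : ℕ) : ℝ) + 1) * η := by
        have := hyθ; rw [hy, hθ] at this; linarith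
      have h3 : 2 * (a : ℝ) = 2 * ((b : ℕ) : ℝ) + 1 := mul_right_cancel₀ hηpos.ne' h2
      have h4 : 2 * a = 2 * (b : ℕ) + 1 := by exact_mod_cast h3
      omega
    have hL : ((∑ l, y ^ d l • T l).submatrix ((↑) : ↥((ON a)ᶜ) → Fin m) ((↑) : ↥((ON a)ᶜ) → Fin m)).det ≠ 0 :=
      hμne
    have hflag := eventually_det_mul_pos_on (∑ l, y ^ d l • T l) σ r (ON a) hrON hσne hrpos hr1 hL
    -- the flag carrier `(∏_{ON} σ) · minor` has the sign of `(-1)^a ∏ λ`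
    have hkey : (∏ b ∈ ON a, σ b) * Λ a = (-1) ^ a * ∏ b, lam b :=
      prod_neg_filter_lt_mul_prod_compl lam a ha
    have hσprod : ∏ b ∈ ON a, σ b ≠ 0 := Finset.prod_ne_zero_iff.mpr fun b _ => hσne b
    have hcar : 0 < ((∏ b ∈ ON a, σ b) * μ a y) * ((-1) ^ a * ∏ b, lam b) := by
      rw [← hkey, show ((∏ b ∈ ON a, σ b) * μ a y) * ((∏ b ∈ ON a, σ b) * Λ a)
        = ((∏ b ∈ ON a, σ b) * ∏ b ∈ ON a, σ b) * (μ a y * Λ a) by ring]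
      exact mul_pos (mul_self_pos.mpr hσprod) hμy
    filter_upwards [hflag] with D hD
    -- sign transfer through the positive square of the flag carrier (Literature `PlanarFoliations.mul_pos_of_mul_pos_of_mul_pos` shape)
    have hD' : 0 < ((∑ l, y ^ d l • T l) + diagonal (fun b => σ b * (y / θ b) ^ D)).det
        * ((∏ b ∈ ON a, σ b) * μ a y) := hD
    have hc₁ : 0 < ((∏ b ∈ ON a, σ b) * μ a y) * ((∏ b ∈ ON a, σ b) * μ a y) :=
      mul_self_pos.mpr (mul_ne_zero hσprod hμne)
    nlinarith [mul_pos hD' hcar, hc₁]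
  -- eventual sign at the OLD test points `τ j ≤ x₀`: the new letter dies, carrier `det F(τ j)`
  have hold : ∀ j : Fin (N + 1), ∀ᶠ D : ℕ in atTop,
      0 < ((∑ l, τ j ^ d l • T l) + diagonal (fun b => σ b * (τ j / θ b) ^ D)).det
          * (∑ l, τ j ^ d l • S l).det := by
    intro j
    have hle : τ j ≤ x₀ := hτ.monotone (Fin.le_last j)
    have hr0 : ∀ b, 0 ≤ τ j / θ b := fun b => div_nonneg (hpos j).le (hθpos b).le
    have hr1 : ∀ b, τ j / θ b < 1 := fun b => (div_lt_one (hθpos b)).mpr (hle.trans_lt (hθgt b))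
    have ht := tendsto_det_add_diagonal_of_lt_one (∑ l, τ j ^ d l • T l) σ (fun b => τ j / θ b) hr0 hr1
    rw [hMc_det] at ht
    exact eventually_mul_pos_of_tendsto ht (hne j)
  -- one `D` for all the finitely many eventual statements
  have hnew' : ∀ᶠ D : ℕ in atTop, ∀ a : Fin (m + 1),
      0 < ((∑ l, (x₀ + 2 * ((a : ℕ) : ℝ) * η) ^ d l • T l)
            + diagonal (fun b => σ b * ((x₀ + 2 * ((a : ℕ) : ℝ) * η) / θ b) ^ D)).det
          * ((-1) ^ (a : ℕ) * ∏ b, lam b) :=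
    eventually_all.mpr fun a => hnew a (Nat.le_of_lt_succ a.isLt)
  have hold' : ∀ᶠ D : ℕ in atTop, ∀ j : Fin (N + 1),
      0 < ((∑ l, τ j ^ d l • T l) + diagonal (fun b => σ b * (τ j / θ b) ^ D)).det
          * (∑ l, τ j ^ d l • S l).det :=
    eventually_all.mpr hold
  have hDgt : ∀ᶠ D : ℕ in atTop, ∀ l : Fin K, d l < D := eventually_all.mpr fun l => eventually_gt_atTop (d l)
  obtain ⟨D, ⟨hDold, hDnew⟩, hDd⟩ := ((hold'.and hnew').and hDgt).exists
  -- the new data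
  set τ' : Fin (N + m + 1) → ℝ := fun j =>
    if h : (j : ℕ) ≤ N then τ ⟨j, Nat.lt_succ_of_le h⟩ else x₀ + 2 * (((j : ℕ) - N : ℕ) : ℝ) * η with hτ'
  set s : Fin (N + m + 1) → ℝ := fun j =>
    if h : (j : ℕ) ≤ N then (∑ l, τ ⟨j, Nat.lt_succ_of_le h⟩ ^ d l • S l).det
    else (-1) ^ ((j : ℕ) - N) * ∏ b, lam b with hs
  have hτ'_old : ∀ (j : Fin (N + m + 1)) (h : (j : ℕ) ≤ N), τ' j = τ ⟨j, Nat.lt_succ_of_le h⟩ :=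
    fun j h => by simp only [hτ', dif_pos h]
  have hτ'_new : ∀ (j : Fin (N + m + 1)), ¬ (j : ℕ) ≤ N → τ' j = x₀ + 2 * (((j : ℕ) - N : ℕ) : ℝ) * η :=
    fun j h => by simp only [hτ', dif_neg h]
  have hs_old : ∀ (j : Fin (N + m + 1)) (h : (j : ℕ) ≤ N),
      s j = (∑ l, τ ⟨j, Nat.lt_succ_of_le h⟩ ^ d l • S l).det :=
    fun j h => by simp only [hs, dif_pos h]
  have hs_new : ∀ (j : Fin (N + m + 1)), ¬ (j : ℕ) ≤ N → s j = (-1) ^ ((j : ℕ) - N) * ∏ b, lam b :=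
    fun j h => by simp only [hs, dif_neg h]
  -- (F1) the carriers carry the signs
  have hF1 : ∀ j : Fin (N + m + 1),
      0 < (∑ l, τ' j ^ (Fin.snoc d D : Fin (K + 1) → ℕ) l •
        (Fin.snoc T (diagonal fun b => σ b * (θ b)⁻¹ ^ D) : Fin (K + 1) → Matrix (Fin m) (Fin m) ℝ) l).det * s j := by
    intro j
    rw [graft_eval]
    by_cases h : (j : ℕ) ≤ N
    · rw [hτ'_old j h, hs_old j h]
      exact hDold ⟨j, Nat.lt_succ_of_le h⟩
    · rw [hτ'_new j h, hs_new j h]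
      exact hDnew ⟨(j : ℕ) - N, by omega⟩
  -- (F2) consecutive carriers have opposite signs
  have hF2 : ∀ j : Fin (N + m), s j.castSucc * s j.succ < 0 := by
    intro j
    have hc : ((Fin.castSucc j : Fin (N + m + 1)) : ℕ) = j := rfl
    have hsu : ((Fin.succ j : Fin (N + m + 1)) : ℕ) = j + 1 := rfl
    by_cases h1 : (j : ℕ) + 1 ≤ N
    · rw [hs_old _ (by rw [hc]; omega), hs_old _ (by rw [hsu]; exact h1)]
      have := halt ⟨j, by omega⟩
      convert this using 3 <;> simp
    · by_cases h2 : (j : ℕ) ≤ N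
      · have hjN : (j : ℕ) = N := by omega
        rw [hs_old _ (by rw [hc]; exact h2), hs_new _ (by rw [hsu]; omega)]
        have hxN : τ ⟨(Fin.castSucc j : ℕ), Nat.lt_succ_of_le (by rw [hc]; exact h2)⟩ = x₀ := by
          rw [hx₀]; congr 1; ext; simp [hjN]
        rw [hxN, ← hM₀, hdetM₀, show ((Fin.succ j : ℕ) - N : ℕ) = 1 by rw [hsu]; omega, pow_one]
        have : 0 < (∏ b, lam b) * ∏ b, lam b := mul_self_pos.mpr hprodne
        linarith
      · rw [hs_new _ (by rw [hc]; exact h2), hs_new _ (by rw [hsu]; omega),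
          show ((Fin.succ j : ℕ) - N : ℕ) = ((Fin.castSucc j : ℕ) - N : ℕ) + 1 by rw [hsu, hc]; omega, pow_succ]
        have : 0 < ((-1 : ℝ) ^ ((Fin.castSucc j : ℕ) - N) * ∏ b, lam b) * ((-1 : ℝ) ^ ((Fin.castSucc j : ℕ) - N) * ∏ b, lam b) :=
          mul_self_pos.mpr (mul_ne_zero (pow_ne_zero _ (by norm_num)) hprodne)
        linarith
  -- assemble
  refine ⟨Fin.snoc d D, Fin.snoc T (diagonal fun b => σ b * (θ b)⁻¹ ^ D), τ', fun l => by simp,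
    fun l => by simpa using hDd l, ?_, ?_, ?_, fun j h0 => ?_,
    fun j => mul_neg_of_carriers (hF1 _) (hF1 _) (hF2 j)⟩
  · -- symmetry of the letters
    intro l
    refine Fin.lastCases ?_ (fun i => ?_) l
    · simp only [Fin.snoc_last]
      exact Matrix.diagonal_transpose _
    · simp only [Fin.snoc_castSucc]
      exact hTsymm i
  · -- strict monotonicity of the test points
    refine Fin.strictMono_iff_lt_succ.mpr fun j => ?_
    have hc : ((Fin.castSucc j : Fin (N + m + 1)) : ℕ) = j := rfl
    have hsu : ((Fin.succ j : Fin (N + m + 1)) : ℕ) = j + 1 := rfl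
    by_cases h1 : (j : ℕ) + 1 ≤ N
    · rw [hτ'_old _ (by rw [hc]; omega), hτ'_old _ (by rw [hsu]; exact h1)]
      exact hτ (Fin.mk_lt_mk.mpr (by rw [hc, hsu]; exact Nat.lt_succ_self _))
    · by_cases h2 : (j : ℕ) ≤ N
      · have hjN : (j : ℕ) = N := by omega
        rw [hτ'_old _ (by rw [hc]; exact h2), hτ'_new _ (by rw [hsu]; omega)]
        have hxN : τ ⟨(Fin.castSucc j : ℕ), Nat.lt_succ_of_le (by rw [hc]; exact h2)⟩ = x₀ := by
          rw [hx₀]; congr 1; ext; simp [hjN]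
        rw [hxN, show ((Fin.succ j : ℕ) - N : ℕ) = 1 by rw [hsu]; omega]
        push_cast
        linarith
      · rw [hτ'_new _ (by rw [hc]; exact h2), hτ'_new _ (by rw [hsu]; omega),
          show ((Fin.succ j : ℕ) - N : ℕ) = ((Fin.castSucc j : ℕ) - N : ℕ) + 1 by rw [hsu, hc]; omega]
        push_cast
        nlinarith
  · -- positivity of the test points
    intro j
    by_cases h : (j : ℕ) ≤ N
    · rw [hτ'_old j h]; exact hpos _
    · rw [hτ'_new j h]
      exact add_pos_of_pos_of_nonneg hx₀pos (mul_nonneg (mul_nonneg zero_le_two (Nat.cast_nonneg _)) hηpos.le)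
  · -- nonvanishing (from the carried sign)
    have h := hF1 j
    rw [h0, zero_mul] at h
    exact lt_irrefl 0 h
/-- **THE GRAFT LAW, iterated**: `j` further letters buy `j·m` further alternations —
`ζ(m, K + j) ≥ ζ_alt(m, K) + j·m`. [folklore] -/
theorem exists_alternating_add {m K N : ℕ}
    (h : ∃ (d : Fin K → ℕ) (S : Fin K → Matrix (Fin m) (Fin m) ℝ) (τ : Fin (N + 1) → ℝ),
      (∀ l, (S l).IsSymm) ∧ StrictMono τ ∧ (∀ j, 0 < τ j) ∧ (∀ j, (∑ l, τ j ^ d l • S l).det ≠ 0) ∧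
      ∀ j : Fin N, (∑ l, τ j.castSucc ^ d l • S l).det * (∑ l, τ j.succ ^ d l • S l).det < 0) (j : ℕ) :
    ∃ (d : Fin (K + j) → ℕ) (S : Fin (K + j) → Matrix (Fin m) (Fin m) ℝ) (τ : Fin (N + j * m + 1) → ℝ),
      (∀ l, (S l).IsSymm) ∧ StrictMono τ ∧ (∀ j, 0 < τ j) ∧ (∀ j, (∑ l, τ j ^ d l • S l).det ≠ 0) ∧
      ∀ i : Fin (N + j * m), (∑ l, τ i.castSucc ^ d l • S l).det * (∑ l, τ i.succ ^ d l • S l).det < 0 := by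
  induction j with
  | zero => exact alternating_transport (by simp) h
  | succ j ih =>
    obtain ⟨d, S, τ, hS, hτ, hpos, hne, halt⟩ := ih
    obtain ⟨d', S', τ', -, -, hS', hτ', hpos', hne', halt'⟩ := exists_alternating_succ d S hS τ hτ hpos hne halt
    exact alternating_transport (by ring) ⟨d', S', τ', hS', hτ', hpos', hne', halt'⟩

end Summit.ValiantsHypothesis.ValiantsHypothesis.Theorems.LacunarySymmetroidMatrixDescartes.Census.Graft
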